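import Literature.NumberTheory.DiophantineGeometry.AVIsogenyTateHoldsProofs
import Literature.AlgebraicGeometry.Motives.BaseChangeAlongInverse
import Mathlib.LinearAlgebra.Basis.VectorSpace
import HarnessLib

/-!
# Global instances on `End⁰(A) = ℚ ⊗_ℤ End A`: finite-dimensional, free, `ℤ`-`ℚ` scalar tower

D. Mumford, *Abelian Varieties* (1970), §19, Corollaries 1–2 of Theorem 3: `End(A)` is a finitely
generated free `ℤ`-module of rank `≤ 4 (dim A)²`, so `End⁰(A) = ℚ ⊗ End(A)` is a finite-dimensional
`ℚ`-algebra.  The tree PROVES this as the (universally quantified) theorem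
`AbelianVariety.finiteDimensional_endAlgebra_holds` (`NumberTheory/DiophantineGeometry/AVIsogenyTateHoldsProofs`),
which every user so far re-introduces by hand (`haveI : Module.Finite ℚ A.endAlgebra := …`).  This file
registers it as an INSTANCE, together with two pieces of plumbing that instance search does not find by
itself on the type `AbelianVariety.endAlgebra A` (whose `Ring` structure `endAlgebra.instRing :=
Algebra.TensorProduct.instRing` carries two `AddCommMonoid` paths that typeclass unification does not
identify — observed 2026-08-21: `Module.Free ℚ A.endAlgebra` fails to synthesize, and `rw`/`simp` with
`Finset.mul_sum` / `Finset.sum_mul` do not fire on `End⁰`; use those lemmas as explicit terms):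

* `instance : Module.Finite ℚ A.endAlgebra` (Mumford §19 Cor. 1–2 of Thm. 3, the tree's theorem);
* `instance : Module.Free ℚ A.endAlgebra` (a vector space over the field `ℚ`; built with the explicit
  `AddCommGroup`/`Module` arguments `Ring.toAddCommGroup` / `Algebra.toModule`);
* `instance : IsScalarTower ℤ ℚ A.endAlgebra` (the tree's theorem `endAlgebra.isScalarTower_int_rat`,
  so far used through `attribute [local instance]`).

No definition, no named fact; any base field.

## References
* [MumfordAV1970] D. Mumford, *Abelian Varieties*, TIFR Studies in Math. 5 (1970), §19 Thm. 3 and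
  Cor. 1–2 (pp. 176–178).
-/

noncomputable section

namespace Literature.AlgebraicGeometry.Motives

namespace AbelianVariety

universe u

variable {K : Type u} [Field K] (A : AbelianVariety K)

/-- **`End⁰(A)` is a finite-dimensional `ℚ`-algebra** (Mumford §19, Cor. 1–2 of Thm. 3), as an
instance (the tree's theorem `finiteDimensional_endAlgebra_holds`).
[cite: MumfordAV1970, §19 Cor. 1–2 of Thm. 3] -/
instance endAlgebra.instModuleFinite : Module.Finite ℚ A.endAlgebra :=
  finiteDimensional_endAlgebra_holds A

/-- `End⁰(A)` is a free `ℚ`-module (every vector space over a field is free); registered explicitly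
because instance search does not bridge the two `AddCommMonoid` structures carried by
`endAlgebra.instRing`. [folklore] -/
instance endAlgebra.instModuleFree : Module.Free ℚ A.endAlgebra :=
  @Module.Free.of_divisionRing ℚ A.endAlgebra _ Ring.toAddCommGroup Algebra.toModule

/-- `ℤ`, `ℚ`, `End⁰(A)` form a scalar tower (the tree's theorem `endAlgebra.isScalarTower_int_rat`,
as a global instance). [folklore] -/
instance endAlgebra.instIsScalarTowerIntRat : IsScalarTower ℤ ℚ A.endAlgebra :=
  endAlgebra.isScalarTower_int_rat A

/-- `dim_ℚ End⁰(A)` is the cardinality of any `ℚ`-basis — a usage check that the `Module.Free` /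
`Module.Finite` instances are found on `End⁰(A)` (`Module.finrank_eq_card_chooseBasisIndex`).
[cite: MumfordAV1970, §19 Cor. 1–2 of Thm. 3] -/
theorem finrank_endAlgebra_eq_card_chooseBasisIndex :
    Module.finrank ℚ A.endAlgebra = Fintype.card (Module.Free.ChooseBasisIndex ℚ A.endAlgebra) :=
  Module.finrank_eq_card_chooseBasisIndex ℚ A.endAlgebra

end AbelianVariety

end Literature.AlgebraicGeometry.Motives

end
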